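import Summits.KontsevichZagierPeriods.KontsevichZagierPeriods.Theses.TorsionLogs
import Summits.KontsevichZagierPeriods.KontsevichZagierPeriods.Theorems.TorsionLogsNeronTorsionSectorAssemblyMain

/-!
# WITNESS (F3 / BC5) for the rung `NeronAddition` — the floor IS the member `addition = false`

`neronAdditionMember_false : NeronAdditionMember false` (sorry-free, two lines) from the SEED
`Summit.KontsevichZagierPeriods.KontsevichZagierPeriods.Cruxes.NeronTorsionSector.Translation.stub_assembly`
(= `Theses.TorsionLogs.NeronTorsionPrimitiveChain_holds`, item stmt-KontsevichZagierPeriods-17981, PROVED): the torsion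
member of the rung is the floor's statement VERBATIM, so the witness is `unfold; exact stub_assembly`, and conversely the
rung hands the floor back (`floor_of_neronAddition`).

HONEST CONTAINMENT NOTE. The rung is the two-member family {torsion member (= floor: ONE real `N`-torsion point, the
finite translation grid), addition member (NEW: three free real algebraic points `P₁, P₂, Q` of the identity component,
the chord abscissae `x(P_i ± Q)`, the second-difference element of the quasi-parallelogram law)}. The addition member
does not contain the floor as a parameter value — the floor is a GLOBAL torsion identity (value `q²I(P) + p²I(O) =
c·log`, obtained from `N − 2` translation cells telescoped around the closed grid), the addition member a LOCAL functional
equation of the same Néron integrals; the floor is recovered from addition members only through `N`-fold telescoping plus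
the exact log relations, which is a proof, not an instantiation. Hence the Bool-member device (precedent:
`Lines/NeronDistribution.lean`, whose member `false` is the degenerate instance `x_Q = e₁`). The witness regime of BOTH
members: real elliptic curves over `ℚ̄ ∩ ℝ`, identity component; Conjecture 1 is not known there as a statement about
the three KZ moves (value-level linear relations among 1-periods are classified by Huber–Wüstholz 2022, Thm 13.3 —
not the moves). Self-contained: verbatim copies of the two `def`s of `Lines/NeronAddition.lean` in the namespace
`…NeronAddition.Special`.
-/

open Set MeasureTheory
open Literature.NumberTheory.Transcendental
open Summit.KontsevichZagierPeriods.KontsevichZagierPeriods.Cruxes.NeronTorsionSector.Translation (stub_assembly)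

namespace Summit.KontsevichZagierPeriods.KontsevichZagierPeriods.Cruxes.TorsionSectorComplete.NeronAddition.Special

/-- MEMBER `addition` of the rung (verbatim copy of `Lines/NeronAddition.lean`).
* `addition = false` — the TORSION member: the floor `TorsionLogs.NeronTorsionPrimitiveChain` verbatim (one real
  `N`-torsion point `P` of the identity component; primitive chain `q²[rI_P] + p²[rP] − c[rB] ∈ relations`).
* `addition = true` — the ADDITION member (NEW): `y² = f(x) = 4x³ − g₂x − g₃`, `Δ ≠ 0`, `e₁` the largest real root,
  three points `P₁ = (x₁,y₁)`, `P₂ = (x₂,y₂)`, `Q = (x_Q,y_Q)` of the identity component with `e₁ < x₂ < x₁ < x_Q`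
  (no torsion, no order, no sign hypothesis), the chord abscissae `x(P_i + Q) = ((y_i − y_Q)/(x_i − x_Q))²/4 − x_i − x_Q`,
  `x(P_i − Q) = ((y_i + y_Q)/(x_i − x_Q))²/4 − x_i − x_Q`, the six Néron triangles
  `rI(x_R) = [{e₁ < x' < x < x_R}, x' dx' dx/(√f(x')√f(x))]` at `x_R ∈ {x(P_i ± Q), x_i}`, the logarithmic carrier
  `rL = [{x_Q − x₁ < t < x_Q − x₂}, dt/t]`, and the value hypothesis (tied form). CLAIM: the second-difference
  ("quasi-parallelogram") element
  `[rI(x(P₂+Q))] + [rI(x(P₂−Q))] − 2[rI(x₂)] − [rI(x(P₁+Q))] − [rI(x(P₁−Q))] + 2[rI(x₁)] + [rL]`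
  is a relation of the KZ move calculus. (Value identity
  `Σ_i (−1)^i [I(P_i+Q) + I(P_i−Q) − 2 I(P_i)] + log((x_Q−x₂)/(x_Q−x₁)) = 0`, verified numerically to `3·10⁻¹⁵`
  on eight configurations incl. `Δ < 0`, `e₁ < 0`, `x₂ → e₁`.) -/
def NeronAdditionMember : Bool → Prop
  | false =>
    ∀ (g₂ g₃ e₁ xP yP : ℝ) (N a p q : ℕ) (f : ℝ → ℝ), (∀ x, f x = 4 * x ^ 3 - g₂ * x - g₃) →
      g₂ ^ 3 - 27 * g₃ ^ 2 ≠ 0 → f e₁ = 0 → 0 < e₁ → (∀ x, e₁ < x → 0 < f x) → e₁ < xP → yP ^ 2 = f xP →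
      3 ≤ N → 0 < a → 2 * a < N →
      (∀ hns : (⟨0, 0, 0, -g₂ / 4, -g₃ / 4⟩ : WeierstrassCurve ℝ).toAffine.Nonsingular xP (yP / 2),
        addOrderOf (WeierstrassCurve.Affine.Point.some xP (yP / 2) hns) = N) →
      (N : ℝ) * (∫ x in Set.Ioi xP, (Real.sqrt (f x))⁻¹) = a * (2 * ∫ x in Set.Ioi e₁, (Real.sqrt (f x))⁻¹) →
      Nat.Coprime p q → (q : ℤ) * ((N : ℤ) - 2 * (a : ℤ)) = (p : ℤ) * (2 * (N : ℤ)) →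
      ∀ (rI rP : KZ.IntegralRep 2),
      rI.domain = {z | e₁ < z 1 ∧ z 1 < z 0 ∧ z 0 < xP} →
      Set.EqOn rI.integrand (fun z => z 1 / (Real.sqrt (f (z 1)) * Real.sqrt (f (z 0)))) rI.domain →
      rP.domain = {z | e₁ < z 0 ∧ e₁ < z 1} →
      Set.EqOn rP.integrand
        (fun z => (Real.sqrt (f (z 0)))⁻¹ * ((g₂ * z 1 + 2 * g₃) / (2 * (z 1) ^ 2 * Real.sqrt (f (z 1))))) rP.domain →
      ∃ (c : ℤ) (B : ℝ) (rB : KZ.IntegralRep 1), 1 < B ∧ IsAlgebraic ℚ B ∧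
        rB.domain = {t | 1 < t 0 ∧ t 0 < B} ∧ Set.EqOn rB.integrand (fun t => (t 0)⁻¹) rB.domain ∧
        ((q : ℤ) ^ 2) • KZ.of rI + ((p : ℤ) ^ 2) • KZ.of rP - c • KZ.of rB ∈ KZ.relations
  | true =>
    ∀ (g₂ g₃ e₁ x₁ y₁ x₂ y₂ xQ yQ xS₁ xD₁ xS₂ xD₂ : ℝ) (f : ℝ → ℝ),
      (∀ x, f x = 4 * x ^ 3 - g₂ * x - g₃) → g₂ ^ 3 - 27 * g₃ ^ 2 ≠ 0 → f e₁ = 0 →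
      (∀ x, e₁ < x → 0 < f x) → e₁ < x₂ → x₂ < x₁ → x₁ < xQ →
      y₁ ^ 2 = f x₁ → y₂ ^ 2 = f x₂ → yQ ^ 2 = f xQ →
      xS₁ = ((y₁ - yQ) / (x₁ - xQ)) ^ 2 / 4 - x₁ - xQ → xD₁ = ((y₁ + yQ) / (x₁ - xQ)) ^ 2 / 4 - x₁ - xQ →
      xS₂ = ((y₂ - yQ) / (x₂ - xQ)) ^ 2 / 4 - x₂ - xQ → xD₂ = ((y₂ + yQ) / (x₂ - xQ)) ^ 2 / 4 - x₂ - xQ →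
      ∀ (rS₁ rD₁ rP₁ rS₂ rD₂ rP₂ : KZ.IntegralRep 2) (rL : KZ.IntegralRep 1),
      rS₁.domain = {z | e₁ < z 1 ∧ z 1 < z 0 ∧ z 0 < xS₁} →
      Set.EqOn rS₁.integrand (fun z => z 1 / (Real.sqrt (f (z 1)) * Real.sqrt (f (z 0)))) rS₁.domain →
      rD₁.domain = {z | e₁ < z 1 ∧ z 1 < z 0 ∧ z 0 < xD₁} →
      Set.EqOn rD₁.integrand (fun z => z 1 / (Real.sqrt (f (z 1)) * Real.sqrt (f (z 0)))) rD₁.domain →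
      rP₁.domain = {z | e₁ < z 1 ∧ z 1 < z 0 ∧ z 0 < x₁} →
      Set.EqOn rP₁.integrand (fun z => z 1 / (Real.sqrt (f (z 1)) * Real.sqrt (f (z 0)))) rP₁.domain →
      rS₂.domain = {z | e₁ < z 1 ∧ z 1 < z 0 ∧ z 0 < xS₂} →
      Set.EqOn rS₂.integrand (fun z => z 1 / (Real.sqrt (f (z 1)) * Real.sqrt (f (z 0)))) rS₂.domain →
      rD₂.domain = {z | e₁ < z 1 ∧ z 1 < z 0 ∧ z 0 < xD₂} →
      Set.EqOn rD₂.integrand (fun z => z 1 / (Real.sqrt (f (z 1)) * Real.sqrt (f (z 0)))) rD₂.domain →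
      rP₂.domain = {z | e₁ < z 1 ∧ z 1 < z 0 ∧ z 0 < x₂} →
      Set.EqOn rP₂.integrand (fun z => z 1 / (Real.sqrt (f (z 1)) * Real.sqrt (f (z 0)))) rP₂.domain →
      rL.domain = {t | xQ - x₁ < t 0 ∧ t 0 < xQ - x₂} → Set.EqOn rL.integrand (fun t => (t 0)⁻¹) rL.domain →
      rS₂.value + rD₂.value - 2 * rP₂.value - rS₁.value - rD₁.value + 2 * rP₁.value + rL.value = 0 →
      KZ.of rS₂ + KZ.of rD₂ - (2 : ℤ) • KZ.of rP₂ - KZ.of rS₁ - KZ.of rD₁ + (2 : ℤ) • KZ.of rP₁ + KZ.of rL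
        ∈ KZ.relations

/-- THE RUNG: both members (verbatim copy of `Lines/NeronAddition.lean`). [cite: KontsevichZagier2001, §1.2] -/
def NeronAddition : Prop := ∀ addition : Bool, NeronAdditionMember addition

/-- Instantiation shape: each member from the rung. [folklore] -/
theorem member_of_rung (h : NeronAddition) (addition : Bool) : NeronAdditionMember addition := h addition

/-- **THE WITNESS (F3 / BC5): member `false` of the rung is the floor `stub_assembly`.** [cite: KontsevichZagier2001, §1.2] -/
theorem neronAdditionMember_false : NeronAdditionMember false := by
  unfold NeronAdditionMember
  exact stub_assembly

/-- The F3 line in the brief's literal shape. [folklore] -/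
example : NeronAdditionMember false := by simpa only [NeronAdditionMember] using stub_assembly

/-- Conversely the rung hands back the floor's statement by name (`specialises`). [folklore] -/
theorem floor_of_neronAddition (h : NeronAddition) :
    Summit.KontsevichZagierPeriods.KontsevichZagierPeriods.Theses.TorsionLogs.NeronTorsionPrimitiveChain := by
  have h0 := h false
  unfold NeronAdditionMember at h0
  exact h0

/-- The floor by name (seed g1-KontsevichZagierPeriods-17981). [folklore] -/
example : Summit.KontsevichZagierPeriods.KontsevichZagierPeriods.Theses.TorsionLogs.NeronTorsionPrimitiveChain :=
  stub_assembly

end Summit.KontsevichZagierPeriods.KontsevichZagierPeriods.Cruxes.TorsionSectorComplete.NeronAddition.Special
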